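import Summits.ValiantsHypothesis.ValiantsHypothesis.Theorems.LiftNullstellensatzLiftWidthPerFourCuts

/-!
# Route LiftNullstellensatz — `LiftWidthPerFour` (item stmt-ValiantsHypothesis-5922): Nisan's
tensor-train normal form

If a word tensor `Ψ` of length `4` has sequential flattenings of ranks `r₁, r₂, r₃` (cuts
`1|3, 2|2, 3|1`), then `Ψ` IS a homogeneous algebraic branching program of format
`(≤ r₁, ≤ r₂, ≤ r₃)`: `Ψ(a b c d) = Σ_{k,s,t} L₁(a)_k L₂(b)_{ks} L₃(c)_{st} L₄(d)_t`
(`exists_tt_of_flattenings`, Nisan 1991), hence its commutative image is the matrix product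
`L₁ · L₂ · L₃ · L₄` of matrices of LINEAR FORMS of sizes `1×r₁, r₁×r₂, r₂×r₃, r₃×1`
(`sum_word_eq_abp`).  Consequently `LiftWidthPerFour` follows from: `per_4` has no homogeneous
ABP of format `(≤5, ≤5, ≤5)` (`liftWidthPerFour_of_forall_abp`) — the form in which the outer
layers can be normalised (they are ideals of `≤ 5` linear forms containing `per_4`).

The proof is the standard one: rank-factorise the first flattening `M₁ = A₁ B₁` with `B₁ = K₁ M₁`
(rows of `B₁` are combinations of rows of `M₁`), regroup `B₁` as a matrix `N₂` indexed by
`(k, b) × (c, d)` whose rows are combinations of rows of the second flattening (`rank N₂ ≤ r₂`),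
factorise again, and once more for the third cut.  No new definitions.
-/

noncomputable section

open MvPolynomial

namespace Summit.ValiantsHypothesis.LiftNullstellensatz

open Literature.Computability.AlgebraicComplexity

variable {F : Type*} [Field F]

/-- **Rank factorisation with a row multiplier**: over a field, every matrix `M` factors as
`M = A · (K · M)` through `Fin (rank M)` — the columns of `A` are a basis of the column space and
`K · M` holds the coordinates of the columns of `M` in that basis (`K` extends the coordinate
functionals to the ambient space).  In particular the rows of the second factor are linear
combinations of the rows of `M`. [folklore] -/
theorem exists_mul_mul_eq_of_rank {m n : Type*} [Fintype m] [Fintype n] [DecidableEq m]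
    (M : Matrix m n F) :
    ∃ (A : Matrix m (Fin M.rank) F) (K : Matrix (Fin M.rank) m F), A * (K * M) = M := by
  classical
  let W : Submodule F (m → F) := Submodule.span F (Set.range M.col)
  have hW : Module.finrank F W = M.rank := (Matrix.rank_eq_finrank_span_cols M).symm
  let b : Module.Basis (Fin M.rank) F W := Module.finBasisOfFinrankEq F W hW
  have hcol : ∀ j, M.col j ∈ W := fun j => Submodule.subset_span ⟨j, rfl⟩
  -- extend the coordinate functionals of `b` to the ambient space
  have hext : ∀ k : Fin M.rank, ∃ g : (m → F) →ₗ[F] F, g.comp W.subtype = b.coord k :=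
    fun k => LinearMap.exists_extend (b.coord k)
  choose g hg using hext
  refine ⟨Matrix.of fun i k => (b k : m → F) i, Matrix.of fun k i => g k (Pi.single i 1), ?_⟩
  ext i j
  have hcolsum : (∑ i', M i' j • (Pi.single i' (1 : F) : m → F)) = M.col j := by
    ext i'
    simp only [Finset.sum_apply, Pi.smul_apply, Pi.single_apply, smul_eq_mul, mul_ite, mul_one,
      mul_zero, Finset.sum_ite_eq, Finset.mem_univ, if_true, Matrix.col_apply]
  have hKM : ∀ k, (Matrix.of (fun k i => g k (Pi.single i 1)) * M) k j = b.repr ⟨M.col j, hcol j⟩ k := by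
    intro k
    rw [Matrix.mul_apply]
    have h1 : (∑ i', (Matrix.of fun k i => g k (Pi.single i (1 : F))) k i' * M i' j) =
        g k (∑ i', M i' j • (Pi.single i' (1 : F) : m → F)) := by
      rw [map_sum]
      refine Finset.sum_congr rfl fun i' _ => ?_
      rw [map_smul, smul_eq_mul, mul_comm, Matrix.of_apply]
    rw [h1, hcolsum]
    have h2 : g k (M.col j) = (g k).comp W.subtype ⟨M.col j, hcol j⟩ := rfl
    rw [h2, hg k]
    rfl
  rw [Matrix.mul_apply]
  have key := congrArg (fun x : W => (x : m → F) i) (b.sum_repr ⟨M.col j, hcol j⟩)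
  simp only [Submodule.coe_sum, Submodule.coe_smul, Finset.sum_apply, Pi.smul_apply,
    smul_eq_mul] at key
  rw [← Matrix.col_apply M j i, ← key]
  refine Finset.sum_congr rfl fun k _ => ?_
  rw [hKM k, Matrix.of_apply, mul_comm]

/-- **Nisan's tensor-train normal form (length 4).**  A 4-tensor `Ψ : α × β × γ × δ → F` whose
three sequential flattenings have ranks `≥ r₁, r₂, r₃`-bounds as below decomposes as
`Ψ(a,b,c,d) = Σ_{k<r₁} Σ_{s<r₂} Σ_{t<r₃} L₁(a)_k L₂(b)_{ks} L₃(c)_{st} L₄(d)_t` with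
`r₁ ≤ rank M₁`, `r₂ ≤ rank M₂`, `r₃ ≤ rank M₃` (homogeneous ABP / matrix-product state of bond
dimensions the flattening ranks). [cite: Nisan1991, Lemma 1 (method)] -/
theorem exists_tt_of_flattenings {α β γ δ : Type*} [Fintype α] [Fintype β] [Fintype γ]
    [Fintype δ] [DecidableEq α] [DecidableEq β] [DecidableEq γ] [DecidableEq δ]
    (Ψ : α → β → γ → δ → F) :
    ∃ (r₁ r₂ r₃ : ℕ),
      r₁ ≤ (Matrix.of fun (a : α) (x : β × γ × δ) => Ψ a x.1 x.2.1 x.2.2).rank ∧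
      r₂ ≤ (Matrix.of fun (x : α × β) (y : γ × δ) => Ψ x.1 x.2 y.1 y.2).rank ∧
      r₃ ≤ (Matrix.of fun (x : α × β × γ) (d : δ) => Ψ x.1 x.2.1 x.2.2 d).rank ∧
      ∃ (L₁ : α → Fin r₁ → F) (L₂ : β → Fin r₁ → Fin r₂ → F) (L₃ : γ → Fin r₂ → Fin r₃ → F)
        (L₄ : δ → Fin r₃ → F),
        ∀ a b c d, Ψ a b c d = ∑ k, ∑ s, ∑ t, L₁ a k * L₂ b k s * L₃ c s t * L₄ d t := by
  classical
  -- the three flattenings, with entry lemmas (never rewrite the matrices themselves: their ranks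
  -- occur in types)
  obtain ⟨M₁, hM₁⟩ : ∃ M₁ : Matrix α (β × γ × δ) F, ∀ a x, M₁ a x = Ψ a x.1 x.2.1 x.2.2 :=
    ⟨Matrix.of fun a x => Ψ a x.1 x.2.1 x.2.2, fun _ _ => rfl⟩
  obtain ⟨M₂, hM₂⟩ : ∃ M₂ : Matrix (α × β) (γ × δ) F, ∀ x y, M₂ x y = Ψ x.1 x.2 y.1 y.2 :=
    ⟨Matrix.of fun x y => Ψ x.1 x.2 y.1 y.2, fun _ _ => rfl⟩
  obtain ⟨M₃, hM₃⟩ : ∃ M₃ : Matrix (α × β × γ) δ F, ∀ x d, M₃ x d = Ψ x.1 x.2.1 x.2.2 d :=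
    ⟨Matrix.of fun x d => Ψ x.1 x.2.1 x.2.2 d, fun _ _ => rfl⟩
  have hM₁' : (Matrix.of fun (a : α) (x : β × γ × δ) => Ψ a x.1 x.2.1 x.2.2) = M₁ := by
    ext a x; rw [Matrix.of_apply, hM₁]
  have hM₂' : (Matrix.of fun (x : α × β) (y : γ × δ) => Ψ x.1 x.2 y.1 y.2) = M₂ := by
    ext x y; rw [Matrix.of_apply, hM₂]
  have hM₃' : (Matrix.of fun (x : α × β × γ) (d : δ) => Ψ x.1 x.2.1 x.2.2 d) = M₃ := by
    ext x d; rw [Matrix.of_apply, hM₃]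
  rw [hM₁', hM₂', hM₃']
  -- first cut
  obtain ⟨A₁, K₁, h₁⟩ := exists_mul_mul_eq_of_rank M₁
  -- second cut: regroup `K₁ M₁` as `N₂ : (k, b) × (c, d)`; its rows are combinations of rows of `M₂`
  obtain ⟨N₂, hN₂⟩ : ∃ N₂ : Matrix (Fin M₁.rank × β) (γ × δ) F,
      ∀ x y, N₂ x y = (K₁ * M₁) x.1 (x.2, y.1, y.2) := ⟨Matrix.of fun x y => _, fun _ _ => rfl⟩
  have hN₂M₂ : N₂ = (Matrix.of fun (x : Fin M₁.rank × β) (z : α × β) =>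
      if x.2 = z.2 then K₁ x.1 z.1 else 0) * M₂ := by
    ext x y
    rw [hN₂, Matrix.mul_apply, Matrix.mul_apply, Fintype.sum_prod_type]
    refine Finset.sum_congr rfl fun a _ => ?_
    simp only [Matrix.of_apply, ite_mul, zero_mul, Finset.sum_ite_eq, Finset.mem_univ, if_true,
      hM₁, hM₂]
  have hr₂ : N₂.rank ≤ M₂.rank := by rw [hN₂M₂]; exact Matrix.rank_mul_le_right _ _
  obtain ⟨A₂, K₂, h₂⟩ := exists_mul_mul_eq_of_rank N₂
  -- third cut
  obtain ⟨N₃, hN₃⟩ : ∃ N₃ : Matrix (Fin N₂.rank × γ) δ F,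
      ∀ x d, N₃ x d = (K₂ * N₂) x.1 (x.2, d) := ⟨Matrix.of fun x d => _, fun _ _ => rfl⟩
  have hN₃M₃ : N₃ = (Matrix.of fun (x : Fin N₂.rank × γ) (z : α × β × γ) =>
      if x.2 = z.2.2 then ∑ k, K₂ x.1 (k, z.2.1) * K₁ k z.1 else 0) * M₃ := by
    ext x d
    -- both sides equal the canonical triple sum
    have lhs : N₃ x d = ∑ k : Fin M₁.rank, ∑ b : β, ∑ a : α,
        K₂ x.1 (k, b) * (K₁ k a * Ψ a b x.2 d) := by
      rw [hN₃, Matrix.mul_apply, Fintype.sum_prod_type]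
      refine Finset.sum_congr rfl fun k _ => Finset.sum_congr rfl fun b _ => ?_
      rw [hN₂, Matrix.mul_apply, Finset.mul_sum]
      refine Finset.sum_congr rfl fun a _ => ?_
      rw [hM₁]
    have rhs : ((Matrix.of fun (x : Fin N₂.rank × γ) (z : α × β × γ) =>
        if x.2 = z.2.2 then ∑ k, K₂ x.1 (k, z.2.1) * K₁ k z.1 else 0) * M₃) x d =
        ∑ a : α, ∑ b : β, ∑ k : Fin M₁.rank, K₂ x.1 (k, b) * (K₁ k a * Ψ a b x.2 d) := by
      rw [Matrix.mul_apply, Fintype.sum_prod_type]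
      refine Finset.sum_congr rfl fun a _ => ?_
      rw [Fintype.sum_prod_type]
      refine Finset.sum_congr rfl fun b _ => ?_
      simp only [Matrix.of_apply, hM₃, ite_mul, zero_mul, Finset.sum_ite_eq, Finset.mem_univ,
        if_true, Finset.sum_mul]
      refine Finset.sum_congr rfl fun k _ => ?_
      ring
    rw [lhs, rhs]
    calc (∑ k : Fin M₁.rank, ∑ b : β, ∑ a : α, K₂ x.1 (k, b) * (K₁ k a * Ψ a b x.2 d))
        = ∑ b : β, ∑ k : Fin M₁.rank, ∑ a : α, K₂ x.1 (k, b) * (K₁ k a * Ψ a b x.2 d) :=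
          Finset.sum_comm
      _ = ∑ b : β, ∑ a : α, ∑ k : Fin M₁.rank, K₂ x.1 (k, b) * (K₁ k a * Ψ a b x.2 d) :=
          Finset.sum_congr rfl fun b _ => Finset.sum_comm
      _ = ∑ a : α, ∑ b : β, ∑ k : Fin M₁.rank, K₂ x.1 (k, b) * (K₁ k a * Ψ a b x.2 d) :=
          Finset.sum_comm
  have hr₃ : N₃.rank ≤ M₃.rank := by rw [hN₃M₃]; exact Matrix.rank_mul_le_right _ _
  obtain ⟨A₃, K₃, h₃⟩ := exists_mul_mul_eq_of_rank N₃
  refine ⟨M₁.rank, N₂.rank, N₃.rank, le_rfl, hr₂, hr₃, fun a k => A₁ a k,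
    fun b k s => A₂ (k, b) s, fun c s t => A₃ (s, c) t, fun d t => (K₃ * N₃) t d, ?_⟩
  intro a b c d
  have e1 : Ψ a b c d = ∑ k, A₁ a k * (K₁ * M₁) k (b, c, d) := by
    have := congrFun (congrFun h₁ a) (b, c, d)
    rw [Matrix.mul_apply] at this
    rw [this, hM₁]
  have e2 : ∀ k, (K₁ * M₁) k (b, c, d) = ∑ s, A₂ (k, b) s * (K₂ * N₂) s (c, d) := by
    intro k
    have := congrFun (congrFun h₂ (k, b)) (c, d)
    rw [Matrix.mul_apply] at this
    rw [← hN₂ (k, b) (c, d), ← this]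
  have e3 : ∀ s, (K₂ * N₂) s (c, d) = ∑ t, A₃ (s, c) t * (K₃ * N₃) t d := by
    intro s
    have := congrFun (congrFun h₃ (s, c)) d
    rw [Matrix.mul_apply] at this
    rw [← hN₃ (s, c) d, ← this]
  rw [e1]
  refine Finset.sum_congr rfl fun k _ => ?_
  rw [e2 k, Finset.mul_sum]
  refine Finset.sum_congr rfl fun s _ => ?_
  rw [e3 s, Finset.mul_sum, Finset.mul_sum]
  refine Finset.sum_congr rfl fun t _ => ?_
  ring

/-- **Nisan's normal form for word tensors of length 4**: if the three sequential flattenings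
(cuts `1|3`, `2|2`, `3|1`, in the route's coordinates) of `Ψ : (Fin 4 → σ) → F` have ranks
`≤ r₁, r₂, r₃`, then `Ψ` is a homogeneous ABP of format `(a, b, c)` with `a ≤ r₁, b ≤ r₂, c ≤ r₃`:
`Ψ(w) = Σ_{k,s,t} L₁(w₀)_k L₂(w₁)_{ks} L₃(w₂)_{st} L₄(w₃)_t`. [cite: Nisan1991, Lemma 1 (method)] -/
theorem exists_abp_of_rank_le {σ : Type*} [Fintype σ] [DecidableEq σ] (Ψ : (Fin 4 → σ) → F)
    {r₁ r₂ r₃ : ℕ} (h₁₃ : 1 + 3 = 4) (h₂₂ : 2 + 2 = 4) (h₃₁ : 3 + 1 = 4)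
    (hr₁ : (Matrix.of fun (u : Fin 1 → σ) (v : Fin 3 → σ) =>
      Ψ (fun t => Fin.append u v (Fin.cast h₁₃.symm t))).rank ≤ r₁)
    (hr₂ : (Matrix.of fun (u : Fin 2 → σ) (v : Fin 2 → σ) =>
      Ψ (fun t => Fin.append u v (Fin.cast h₂₂.symm t))).rank ≤ r₂)
    (hr₃ : (Matrix.of fun (u : Fin 3 → σ) (v : Fin 1 → σ) =>
      Ψ (fun t => Fin.append u v (Fin.cast h₃₁.symm t))).rank ≤ r₃) :
    ∃ (a b c : ℕ), a ≤ r₁ ∧ b ≤ r₂ ∧ c ≤ r₃ ∧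
      ∃ (L₁ : σ → Fin a → F) (L₂ : σ → Fin a → Fin b → F) (L₃ : σ → Fin b → Fin c → F)
        (L₄ : σ → Fin c → F),
        ∀ w : Fin 4 → σ, Ψ w = ∑ k, ∑ s, ∑ t, L₁ (w 0) k * L₂ (w 1) k s * L₃ (w 2) s t * L₄ (w 3) t := by
  classical
  obtain ⟨a, b, c, ha, hb, hc, L₁, L₂, L₃, L₄, hL⟩ :=
    exists_tt_of_flattenings (F := F) (fun (a b c d : σ) => Ψ ![a, b, c, d])
  -- identify the route's flattenings with the product-indexed ones (reindexing by equivalences)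
  let e₁ : (Fin 1 → σ) ≃ σ := Equiv.funUnique (Fin 1) σ
  let e₂ : (Fin 2 → σ) ≃ σ × σ :=
    ⟨fun u => (u 0, u 1), fun x => ![x.1, x.2], fun u => by funext i; fin_cases i <;> rfl,
      fun x => rfl⟩
  let e₃ : (Fin 3 → σ) ≃ σ × σ × σ :=
    ⟨fun u => (u 0, u 1, u 2), fun x => ![x.1, x.2.1, x.2.2],
      fun u => by funext i; fin_cases i <;> rfl, fun x => rfl⟩
  have k₁ : ∀ (u : Fin 1 → σ) (v : Fin 3 → σ),
      (fun t : Fin 4 => Fin.append u v (Fin.cast h₁₃.symm t)) = ![u 0, v 0, v 1, v 2] :=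
    fun u v => by funext t; fin_cases t <;> rfl
  have k₂ : ∀ (u : Fin 2 → σ) (v : Fin 2 → σ),
      (fun t : Fin 4 => Fin.append u v (Fin.cast h₂₂.symm t)) = ![u 0, u 1, v 0, v 1] :=
    fun u v => by funext t; fin_cases t <;> rfl
  have k₃ : ∀ (u : Fin 3 → σ) (v : Fin 1 → σ),
      (fun t : Fin 4 => Fin.append u v (Fin.cast h₃₁.symm t)) = ![u 0, u 1, u 2, v 0] :=
    fun u v => by funext t; fin_cases t <;> rfl
  have q₁ : (Matrix.of fun (u : Fin 1 → σ) (v : Fin 3 → σ) =>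
      Ψ (fun t => Fin.append u v (Fin.cast h₁₃.symm t))) =
      (Matrix.of fun (a : σ) (x : σ × σ × σ) => Ψ ![a, x.1, x.2.1, x.2.2]).submatrix e₁ e₃ := by
    ext u v
    rw [Matrix.submatrix_apply, Matrix.of_apply, Matrix.of_apply, k₁]
    rfl
  have q₂ : (Matrix.of fun (u : Fin 2 → σ) (v : Fin 2 → σ) =>
      Ψ (fun t => Fin.append u v (Fin.cast h₂₂.symm t))) =
      (Matrix.of fun (x : σ × σ) (y : σ × σ) => Ψ ![x.1, x.2, y.1, y.2]).submatrix e₂ e₂ := by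
    ext u v
    rw [Matrix.submatrix_apply, Matrix.of_apply, Matrix.of_apply, k₂]
    rfl
  have q₃ : (Matrix.of fun (u : Fin 3 → σ) (v : Fin 1 → σ) =>
      Ψ (fun t => Fin.append u v (Fin.cast h₃₁.symm t))) =
      (Matrix.of fun (x : σ × σ × σ) (d : σ) => Ψ ![x.1, x.2.1, x.2.2, d]).submatrix e₃ e₁ := by
    ext u v
    rw [Matrix.submatrix_apply, Matrix.of_apply, Matrix.of_apply, k₃]
    rfl
  rw [q₁, Matrix.rank_submatrix] at hr₁
  rw [q₂, Matrix.rank_submatrix] at hr₂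
  rw [q₃, Matrix.rank_submatrix] at hr₃
  refine ⟨a, b, c, ha.trans hr₁, hb.trans hr₂, hc.trans hr₃, L₁, L₂, L₃, L₄, fun w => ?_⟩
  have hw : w = ![w 0, w 1, w 2, w 3] := by funext t; fin_cases t <;> rfl
  conv_lhs => rw [hw]
  exact hL _ _ _ _

/-- **Commutative image of a homogeneous ABP**: summing the tensor train over all words gives the
matrix product of the layers of linear forms,
`Σ_w Ψ(w)·x_{w₀}x_{w₁}x_{w₂}x_{w₃} = Σ_{k,s,t} ℓ₁_k · ℓ₂_{ks} · ℓ₃_{st} · ℓ₄_t` with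
`ℓ₁_k = Σ_a L₁(a)_k x_a` etc. [folklore] -/
theorem sum_word_eq_abp {σ : Type*} [Fintype σ] [DecidableEq σ] {R : Type*} [CommSemiring R]
    {a b c : ℕ} (Ψ : (Fin 4 → σ) → R) (L₁ : σ → Fin a → R) (L₂ : σ → Fin a → Fin b → R)
    (L₃ : σ → Fin b → Fin c → R) (L₄ : σ → Fin c → R)
    (hΨ : ∀ w : Fin 4 → σ,
      Ψ w = ∑ k, ∑ s, ∑ t, L₁ (w 0) k * L₂ (w 1) k s * L₃ (w 2) s t * L₄ (w 3) t) :
    (∑ w : Fin 4 → σ, Ψ w • ∏ t, (X (w t) : MvPolynomial σ R)) =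
      ∑ k, ∑ s, ∑ t, (∑ x, L₁ x k • (X x : MvPolynomial σ R)) * (∑ x, L₂ x k s • X x) *
        (∑ x, L₃ x s t • X x) * (∑ x, L₄ x t • X x) := by
  classical
  -- both sides equal the double sum over (letters) × (bond indices)
  -- (letters are listed in REVERSE order in `x`, to match the expansion order of the product)
  let T : (σ × σ × σ × σ) → (Fin a × Fin b × Fin c) → R :=
    fun x y => L₁ x.2.2.2 y.1 * L₂ x.2.2.1 y.1 y.2.1 * L₃ x.2.1 y.2.1 y.2.2 * L₄ x.1 y.2.2
  let m : (σ × σ × σ × σ) → MvPolynomial σ R :=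
    fun x => X x.2.2.2 * X x.2.2.1 * X x.2.1 * X x.1
  have lhs : (∑ w : Fin 4 → σ, Ψ w • ∏ t, (X (w t) : MvPolynomial σ R)) =
      ∑ x : σ × σ × σ × σ, ∑ y : Fin a × Fin b × Fin c, T x y • m x := by
    let e₄ : (Fin 4 → σ) ≃ σ × σ × σ × σ :=
      ⟨fun w => (w 3, w 2, w 1, w 0), fun x => ![x.2.2.2, x.2.2.1, x.2.1, x.1],
        fun w => by funext i; fin_cases i <;> rfl, fun x => rfl⟩
    refine Fintype.sum_equiv e₄ _ _ fun w => ?_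
    rw [Fin.prod_univ_four, hΨ w, Finset.sum_smul, Fintype.sum_prod_type]
    refine Finset.sum_congr rfl fun k _ => ?_
    rw [Finset.sum_smul, Fintype.sum_prod_type]
    refine Finset.sum_congr rfl fun s _ => ?_
    rw [Finset.sum_smul]
    rfl
  have rhs : (∑ k, ∑ s, ∑ t, (∑ x, L₁ x k • (X x : MvPolynomial σ R)) * (∑ x, L₂ x k s • X x) *
        (∑ x, L₃ x s t • X x) * (∑ x, L₄ x t • X x)) =
      ∑ y : Fin a × Fin b × Fin c, ∑ x : σ × σ × σ × σ, T x y • m x := by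
    rw [Fintype.sum_prod_type]
    refine Finset.sum_congr rfl fun k _ => ?_
    rw [Fintype.sum_prod_type]
    refine Finset.sum_congr rfl fun s _ => Finset.sum_congr rfl fun t _ => ?_
    simp only [Fintype.sum_prod_type, Finset.sum_mul, Finset.mul_sum]
    refine Finset.sum_congr rfl fun x₁ _ => Finset.sum_congr rfl fun x₂ _ =>
      Finset.sum_congr rfl fun x₃ _ => Finset.sum_congr rfl fun x₄ _ => ?_
    simp only [T, m, smul_eq_C_mul, map_mul]
    ring
  rw [lhs, rhs, Finset.sum_comm]

/-- **ABP reduction for `LiftWidthPerFour`.**  It suffices to show that `per_4` has no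
homogeneous algebraic branching program of format `(a, b, c)` with `a, b, c ≤ 5`, i.e.
`per_4 ≠ L₁ · L₂ · L₃ · L₄` for matrices of linear forms of sizes `1×a, a×b, b×c, c×1`
(Nisan: a lift with flattening ranks `(a,b,c)` IS such a program).  This is the normal form in
which the outer layers can be classified (`per_4` lies in the ideal of the `≤ 5` entries of
`L₁`, resp. of `L₄`). [cite: Nisan1991, Lemma 1 (method)] -/
theorem liftWidthPerFour_of_forall_abp
    (H : ∀ a b c : ℕ, a ≤ 5 → b ≤ 5 → c ≤ 5 →
      ∀ (L₁ : Fin 4 × Fin 4 → Fin a → ℂ) (L₂ : Fin 4 × Fin 4 → Fin a → Fin b → ℂ)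
        (L₃ : Fin 4 × Fin 4 → Fin b → Fin c → ℂ) (L₄ : Fin 4 × Fin 4 → Fin c → ℂ),
      perPoly (Fin 4) ℂ ≠ ∑ k, ∑ s, ∑ t,
        (∑ x, L₁ x k • (X x : MvPolynomial (Fin 4 × Fin 4) ℂ)) * (∑ x, L₂ x k s • X x) *
        (∑ x, L₃ x s t • X x) * (∑ x, L₄ x t • X x)) :
    Summit.ValiantsHypothesis.ValiantsHypothesis.Theses.LiftNullstellensatz.LiftWidthPerFour := by
  unfold ValiantsHypothesis.Theses.LiftNullstellensatz.LiftWidthPerFour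
  intro Ψ hΨ
  by_contra hno
  push Not at hno
  have h13 := hno 1 3 rfl
  have h22 := hno 2 2 rfl
  have h31 := hno 3 1 rfl
  obtain ⟨a, b, c, ha, hb, hc, L₁, L₂, L₃, L₄, hL⟩ :=
    exists_abp_of_rank_le (F := ℂ) Ψ rfl rfl rfl (Nat.le_of_lt_succ h13) (Nat.le_of_lt_succ h22)
      (Nat.le_of_lt_succ h31)
  have himg := sum_word_eq_abp Ψ L₁ L₂ L₃ L₄ hL
  rw [hΨ] at himg
  exact H a b c ha hb hc L₁ L₂ L₃ L₄ himg

end Summit.ValiantsHypothesis.LiftNullstellensatz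

end
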